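import Mathlib
import HarnessLib
import Literature.AlgebraicGeometry.Ramification.InertiaNormalSylow
import Literature.AlgebraicGeometry.Resolution.Blowups
import Literature.AlgebraicGeometry.Resolution.MarkedIdeals
import Summits.ResolutionOfSingularities.ResolutionOfSingularities.Theorems.WildQuotientsWildQuotientResolutionStubFlagCore
import Summits.ResolutionOfSingularities.ResolutionOfSingularities.Theorems.WildQuotientsWildQuotientResolutionCentreBlowupStalkData
import Summits.ResolutionOfSingularities.ResolutionOfSingularities.Theorems.WildQuotientsWildQuotientResolutionCentreRsop
import Literature.AlgebraicGeometry.Resolution.RegularCentreRsopPart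

/-!
# Inertia over a blown-up stable centre of embedding codimension `≤ 1` with `dim J̄ ≤ 2` is p-closed — scheme form (crux `WildQuotients.WildQuotientResolution`, Phase 0)

Crux stmt-ResolutionOfSingularities-15640 (`WildQuotientResolution`), line `Sketch` (card
`p-closure-sylow-separation`), registered stub `stub_phaseZeroHighDim` (= PhaseZeroModel for
`dim X′ ≥ 3`). The scheme-level form of the one-step engine `FlagCore.stub_flagCore`
(`Theorems/…StubFlagCore.lean`), fed by the local package of an equivariant blow-up of an
arbitrary stable centre `CentreBlowupStalkData.centreBlowupStalkData`
(`Theorems/…CentreBlowupStalkData.lean`): for the blow-up `π : X♯ → X′` of a `G`-stable ideal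
sheaf `𝒥` on the integral locally Noetherian `X′` (faithful action over the affine `q`, lifted to
`X♯`), at every point `x` over a point `z` at which the stalk `J = 𝒥_z` is cut out, modulo `𝔪_z²`,
by two elements spanning a subspace of codimension `≤ 1` of `𝔪_z/𝔪_z²` with `J ∩ 𝔪_z² ⊆ 𝔪_z J`
— e.g. `z` a point of a REGULAR `G`-stable CURVE on a regular THREEFOLD, `J` generated by two of
three regular parameters — the inertia group `I_x` has a normal Sylow `p`-subgroup. This is the
dimension-`3` statement "blowing up a regularised curve of non-p-closed inertia removes it": no
point over the curve has non-p-closed inertia. (The residue characteristics are taken as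
hypotheses; over a field of characteristic `p` they hold by `PhaseZeroDimTwo.charP_residueField`.)

* `hasNormalSylow_inertia_of_centreBlowup` — the algebraic-hypotheses form.
* `hasNormalSylow_inertia_of_regularCentreBlowup_three` — the geometric form: `V(𝒥)` a REGULAR
  scheme, `𝒪_{X′,z}` regular of dimension `3`, `𝒪_{X′,z}/𝒥_z` of dimension `1` (a regular stable
  curve on a regular threefold) ⟹ every inertia group over `z` is p-closed
  (`exists_isRsopPart_fin_span_range_eq_stalkIdeal` + `CentreRsop.flagCore_data_of_isRsopPart_two`).

[OURS · crux stmt-ResolutionOfSingularities-15640 · helper toward `stub_phaseZeroHighDim`; counted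
0; AI-level work, weaker than expert review.]
-/

-- single-problem summit: the doubled namespace component `ResolutionOfSingularities` is forced
set_option linter.dupNamespace false

namespace Summit.ResolutionOfSingularities.ResolutionOfSingularities.Theorems.WildQuotientResolution.CentreBlowupInertia

open CategoryTheory AlgebraicGeometry TopologicalSpace IsLocalRing
open Literature.AlgebraicGeometry.Resolution Literature.AlgebraicGeometry.Ramification
open Summit.ResolutionOfSingularities.ResolutionOfSingularities.Theorems.WildQuotientResolution.CentreBlowupStalkData
open Summit.ResolutionOfSingularities.ResolutionOfSingularities.Theorems.WildQuotientResolution.CentreRsop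

/-- **Inertia over a blown-up stable centre with `dim J̄ ≤ 2`, `codim J̄ ≤ 1` is p-closed.** Let
`π : X♯ → X′` be a blowing up of the integral locally Noetherian `X′` along a `G`-stable ideal sheaf
`𝒥` (`G` finite acting faithfully over the affine `q`, the action lifted to `X♯` with `π`
equivariant), `x ∈ X♯`, `z = π x`, residue characteristics `p` at `z` and `x`. If the stalk
`J = 𝒥_z ≤ 𝔪_z` satisfies `J ∩ 𝔪_z² ⊆ 𝔪_z J`, is spanned modulo `𝔪_z²` by two of its elements, and
`𝔪_z = J + R v₀` modulo `𝔪_z²` (the local algebra at a point of a regular stable curve on a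
regular threefold), then the inertia group `I_x` has a normal Sylow `p`-subgroup
(`centreBlowupStalkData` + `FlagCore.stub_flagCore`). [folklore] -/
theorem hasNormalSylow_inertia_of_centreBlowup (p : ℕ) [Fact p.Prime]
    {X' X₁ : Scheme.{0}} (q : X' ⟶ X₁) [IsAffineHom q]
    {G : Type} [Group G] [Finite G] (ρ : G →* Aut X') (hfaith : Function.Injective ρ)
    (hρ : ∀ g : G, (ρ g).hom ≫ q = q) [IsIntegral X'] [IsLocallyNoetherian X']
    (𝒥 : X'.IdealSheafData) (h𝒥 : ∀ g : G, 𝒥.comap (ρ g).hom = 𝒥)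
    {Xs : Scheme.{0}} {π : Xs ⟶ X'} (hπ : IsBlowup π 𝒥) [IsIntegral Xs]
    (ρs : G →* Aut Xs) (hequiv : ∀ g : G, (ρs g).hom ≫ π = π ≫ (ρ g).hom) (x : Xs)
    [CharP (ResidueField (X'.presheaf.stalk (π.base x))) p]
    [CharP (ResidueField (Xs.presheaf.stalk x)) p]
    (hJm : stalkIdeal 𝒥 (π.base x) ≤ maximalIdeal (X'.presheaf.stalk (π.base x)))
    (hJ2 : stalkIdeal 𝒥 (π.base x) ⊓ maximalIdeal (X'.presheaf.stalk (π.base x)) ^ 2 ≤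
      maximalIdeal (X'.presheaf.stalk (π.base x)) * stalkIdeal 𝒥 (π.base x))
    (hJgen : ∃ j₁ ∈ stalkIdeal 𝒥 (π.base x), ∃ j₂ ∈ stalkIdeal 𝒥 (π.base x),
      ∀ j ∈ stalkIdeal 𝒥 (π.base x), ∃ a b : X'.presheaf.stalk (π.base x),
        j - (a * j₁ + b * j₂) ∈ maximalIdeal (X'.presheaf.stalk (π.base x)) ^ 2)
    (hVgen : ∃ v₀ ∈ maximalIdeal (X'.presheaf.stalk (π.base x)),
      ∀ r ∈ maximalIdeal (X'.presheaf.stalk (π.base x)), ∃ a : X'.presheaf.stalk (π.base x),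
        ∃ j ∈ stalkIdeal 𝒥 (π.base x),
          r - (a * v₀ + j) ∈ maximalIdeal (X'.presheaf.stalk (π.base x)) ^ 2) :
    HasNormalSylow p (inertiaSubgroup ρs x) := by
  obtain ⟨τ, τ₁, t, hτ, hcomp, hres, hJτ, ht, hgen, hι⟩ :=
    centreBlowupStalkData q ρ hfaith hρ 𝒥 h𝒥 hπ ρs hequiv x
  exact FlagCore.stub_flagCore p (π.stalkMap x).hom hι (stalkIdeal 𝒥 (π.base x)) hJm hJ2 hJgen
    hVgen t ht hgen τ τ₁ hτ hJτ hcomp hres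

/-- **Over a blown-up regular stable curve on a regular threefold every inertia group is
p-closed** (Phase 0, dimension `3`: blowing up a regularised curve of non-p-closed inertia
removes it; crux stmt-ResolutionOfSingularities-15640, toward `stub_phaseZeroHighDim`). Let
`π : X♯ → X′` be the blowing up of the integral locally Noetherian `X′` along a `G`-stable ideal
sheaf `𝒥` whose closed subscheme `V(𝒥)` is REGULAR (`G` finite acting faithfully over the affine
`q`, the action lifted to `X♯` with `π` equivariant), `x ∈ X♯` over `z = π x ∈ V(𝒥)` with
`𝒪_{X′,z}` regular of dimension `3` and `𝒪_{X′,z}/𝒥_z` of dimension `1`, residue characteristics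
`p` at `z` and `x`. Then `I_x` has a normal Sylow `p`-subgroup: `𝒥_z` is generated by two of three
regular parameters (`exists_isRsopPart_fin_span_range_eq_stalkIdeal`, Matsumura 14.2), which gives
the flag hypotheses (`CentreRsop.flagCore_data_of_isRsopPart_two`) of
`hasNormalSylow_inertia_of_centreBlowup`. [folklore] -/
theorem hasNormalSylow_inertia_of_regularCentreBlowup_three (p : ℕ) [Fact p.Prime]
    {X' X₁ : Scheme.{0}} (q : X' ⟶ X₁) [IsAffineHom q]
    {G : Type} [Group G] [Finite G] (ρ : G →* Aut X') (hfaith : Function.Injective ρ)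
    (hρ : ∀ g : G, (ρ g).hom ≫ q = q) [IsIntegral X'] [IsLocallyNoetherian X']
    (𝒥 : X'.IdealSheafData) (h𝒥 : ∀ g : G, 𝒥.comap (ρ g).hom = 𝒥)
    (hC : Literature.AlgebraicGeometry.Resolution.Scheme.IsRegular 𝒥.subscheme)
    {Xs : Scheme.{0}} {π : Xs ⟶ X'} (hπ : IsBlowup π 𝒥) [IsIntegral Xs]
    (ρs : G →* Aut Xs) (hequiv : ∀ g : G, (ρs g).hom ≫ π = π ≫ (ρ g).hom) (x : Xs)
    [CharP (ResidueField (X'.presheaf.stalk (π.base x))) p]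
    [CharP (ResidueField (Xs.presheaf.stalk x)) p]
    [IsRegularLocalRing (X'.presheaf.stalk (π.base x))]
    (hx : π.base x ∈ 𝒥.support)
    (hdim3 : ringKrullDim (X'.presheaf.stalk (π.base x)) = (3 : ℕ))
    (hdim1 : ringKrullDim (X'.presheaf.stalk (π.base x) ⧸ stalkIdeal 𝒥 (π.base x)) = (1 : ℕ)) :
    HasNormalSylow p (inertiaSubgroup ρs x) := by
  have hdim : ringKrullDim (X'.presheaf.stalk (π.base x) ⧸ stalkIdeal 𝒥 (π.base x)) + ((2 : ℕ) : ℕ) =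
      ringKrullDim (X'.presheaf.stalk (π.base x)) := by
    rw [hdim1, hdim3]
    rfl
  obtain ⟨c, hc, hcJ⟩ := exists_isRsopPart_fin_span_range_eq_stalkIdeal hC hx hdim
  obtain ⟨hJm, hJ2, hJgen, hVgen⟩ := flagCore_data_of_isRsopPart_two hc hdim3 hcJ
  exact hasNormalSylow_inertia_of_centreBlowup p q ρ hfaith hρ 𝒥 h𝒥 hπ ρs hequiv x hJm hJ2 hJgen
    hVgen

end Summit.ResolutionOfSingularities.ResolutionOfSingularities.Theorems.WildQuotientResolution.CentreBlowupInertia
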